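import Literature.AnabelianGeometry.SemiGraphs.TemperedPiLevelCosetIso
import Literature.AnabelianGeometry.SemiGraphs.SubgroupPresentationVertexGenerated
import Literature.AnabelianGeometry.SemiGraphs.TemperedPiDeckCompact
import HarnessLib

/-!
# The tree levels `ker ρ_n` contain the vertex groups of the finite levels `ker π_n` ([SemiAnbd] Prop 3.6, Thm 3.7 (iii))

Mochizuki, *Semi-graphs of anabelioids*, Publ. RIMS **42** (2006), Prop. 3.6 p. 38 ("`𝒢_{∞,i} → 𝒢_i`
… the universal graph-covering": its deck group `π₁(𝔾_i)` acts freely) and §3 proof of Thm. 3.7 (iii)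
p. 41 ("`H` fixes at least one vertex of `𝒢_{∞,i}`") [cite: MochizukiSemiAnbd2006, Thm 3.7(iii) p.41].

Cell row T54-B (plan/GAP-LEDGER.md G-w4d053-1), residual E1, file T4b: in abc-iut-L3-t9's Galois tower
with point sequences `T` and reference branches `R`, every vertex group of the finite level
`N_n = ker π_n` — i.e. every `N_n ∩ g H_w g⁻¹`, `H_w = (T w).decompHom.range` — lies in the tree level
`ker ρ_n` (`ker_piLevelAut_inf_conj_le`: such an element is a deck transformation of `𝒢_{∞,n} → 𝒢_{S n}`
fixing a vertex of the tree `𝒢_{∞,n}`, hence trivial by abc-iut-L3-t6's freeness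
`gal_eq_one_of_descendBaseAut_eq_one_of_fixes`); hence `vertSup (ker π_n) ≤ ker ρ_n` and, `ker ρ_n`
being open hence closed, `vertGen (ker π_n) ≤ ker ρ_n`.  CONSEQUENCE (`hK_of_vertGen`): modulo the
REVERSE inclusion `ker ρ_n ≤ vertGen (ker π_n)` ("`ker (π₁^temp(𝒢_n) ↠ π₁(𝔾_n))` is topologically
generated by the verticial subgroups" — the named residual of E1, binder `hgen`), the Φ-stability of the
tree levels (binder `hK` of `ArithTreeTower.lean`) follows from that of the finite levels (binder `hN` of
`ArithLevelTower.lean`) for continuous compatible `Φ`.  Nothing here bears on [IUTchIII] Cor. 3.12.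
-/

namespace Literature.AnabelianGeometry.SemiGraphs

namespace ProfiniteSemiGraph

namespace GaloisLevelData

open CategoryTheory

universe u v

variable {𝒢 : ProfiniteSemiGraph.{u}} (D : GaloisLevelData 𝒢) (h𝒢 : 𝒢.IsCountable)
  (hconn : ∀ (n : ℕ) (p q : (D.S n).Point), (D.S n).SameComponent p q)
  (T : ∀ w : 𝒢.graph.Vertex, D.PointSeq h𝒢 w) (R : SemiGraph.RefBranches 𝒢.graph)

/-- **The vertex groups of the finite level `ker π_n` lie in the tree level `ker ρ_n`**: an element of
`ker π_n ∩ g H_w g⁻¹` is a deck transformation of `𝒢_{∞,n} → 𝒢_{S n}` fixing the vertex `H_w g⁻¹` of the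
tree, hence trivial on `𝒢_{∞,n}`. [cite: MochizukiSemiAnbd2006, Thm 3.7(iii) p.41] -/
theorem ker_piLevelAut_inf_conj_le (n : ℕ) (w : 𝒢.graph.Vertex) (g : D.temperedPi h𝒢) :
    (D.piLevelAut h𝒢 hconn n).ker ⊓ ((D.piPresentation h𝒢 T R).H w).map (MulAut.conj g).toMonoidHom ≤
      (D.projAut h𝒢 n).ker := by
  intro x hx
  obtain ⟨hx1, hx2⟩ := Subgroup.mem_inf.mp hx
  rw [MonoidHom.mem_ker] at hx1
  rw [MonoidHom.mem_ker]
  -- the vertex `H_w g⁻¹` of the coset tree is fixed by the deck action of `x`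
  have hfix : ((D.piPresentation h𝒢 T R).deckAct (D.projAut h𝒢 n).ker x).hom.vertexMap
      ((D.piPresentation h𝒢 T R).vMk (D.projAut h𝒢 n).ker w g⁻¹) =
        (D.piPresentation h𝒢 T R).vMk (D.projAut h𝒢 n).ker w g⁻¹ := by
    rw [SemiGraph.SubgroupPresentation.deckAct_vertexMap_vMk]
    obtain ⟨d, hd, rfl⟩ := hx2
    refine congrArg (Sigma.mk w) ((DoubleCoset.eq _ _ _ _).mpr ⟨d, hd, 1, one_mem _, ?_⟩)
    simp only [MulEquiv.coe_toMonoidHom, MulAut.conj_apply]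
    group
  -- transport to abc-iut-L3-t6's tree `𝔾̃_n`
  have h := congrArg
    (fun φ => φ.vertexMap ((D.piPresentation h𝒢 T R).vMk (D.projAut h𝒢 n).ker w g⁻¹))
    (D.deckAct_comp_treeCosetIso h𝒢 T R n x)
  change (D.treeCosetIso h𝒢 T R n).hom.vertexMap
      (((D.piPresentation h𝒢 T R).deckAct (D.projAut h𝒢 n).ker x).hom.vertexMap
        ((D.piPresentation h𝒢 T R).vMk (D.projAut h𝒢 n).ker w g⁻¹)) =
    (D.treeAct h𝒢 n x).hom.vertexMap ((D.treeCosetIso h𝒢 T R n).hom.vertexMap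
      ((D.piPresentation h𝒢 T R).vMk (D.projAut h𝒢 n).ker w g⁻¹)) at h
  rw [hfix] at h
  -- freeness of the deck action on the tree
  exact D.gal_eq_one_of_descendBaseAut_eq_one_of_fixes h𝒢 hconn n (D.proj h𝒢 n x) hx1 _ h.symm

/-- **`vertSup (ker π_n) ≤ ker ρ_n`.** [cite: MochizukiSemiAnbd2006, Thm 3.7(iii) p.41] -/
theorem vertSup_ker_piLevelAut_le (n : ℕ) :
    (D.piPresentation h𝒢 T R).vertSup (D.piLevelAut h𝒢 hconn n).ker ≤ (D.projAut h𝒢 n).ker :=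
  iSup_le fun p => D.ker_piLevelAut_inf_conj_le h𝒢 hconn T R n p.1 p.2

/-- `ker ρ_n` is closed (it is open). [cite: MochizukiSemiAnbd2006, Thm 3.7(iii) p.41] -/
theorem isClosed_ker_projAut (n : ℕ) : IsClosed ((D.projAut h𝒢 n).ker : Set (D.temperedPi h𝒢)) :=
  Subgroup.isClosed_of_isOpen _ (D.isOpen_ker_proj h𝒢 n)

/-- **`vertGen (ker π_n) ≤ ker ρ_n`**: the verticially generated part of the finite level lies in the
tree level. [cite: MochizukiSemiAnbd2006, Thm 3.7(iii) p.41] -/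
theorem vertGen_ker_piLevelAut_le (n : ℕ) :
    (D.piPresentation h𝒢 T R).vertGen (D.piLevelAut h𝒢 hconn n).ker ≤ (D.projAut h𝒢 n).ker :=
  (D.piPresentation h𝒢 T R).vertGen_le_of_le (D.isClosed_ker_projAut h𝒢 n)
    (D.vertSup_ker_piLevelAut_le h𝒢 hconn T R n)

/-- **E1 reduction: the Φ-stability of the tree levels follows from that of the finite levels**, for a
continuous arithmetically compatible action, MODULO the reverse inclusion `ker ρ_n ≤ vertGen (ker π_n)`
(binder `hgen`: the kernel of `π₁^temp(𝒢_{S n}) ↠ π₁(𝔾_{S n})` is topologically generated by the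
verticial subgroups). [cite: MochizukiSemiAnbd2006, Thm 5.4, p. 66] -/
theorem hK_of_vertGen {E : Type v} [Group E] {Φ : E →* MulAut (D.temperedPi h𝒢)}
    {σ : E →* Aut 𝒢.graph} (hP : (D.piPresentation h𝒢 T R).IsArithCompatible Φ σ)
    (hc : ∀ e : E, Continuous (Φ e))
    (hgen : ∀ n, (D.projAut h𝒢 n).ker ≤ (D.piPresentation h𝒢 T R).vertGen (D.piLevelAut h𝒢 hconn n).ker)
    (hN : ∀ (n : ℕ) (e : E) (x : D.temperedPi h𝒢),
      x ∈ (D.piLevelAut h𝒢 hconn n).ker → Φ e x ∈ (D.piLevelAut h𝒢 hconn n).ker)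
    (n : ℕ) (e : E) (x : D.temperedPi h𝒢) (hx : x ∈ (D.projAut h𝒢 n).ker) :
    Φ e x ∈ (D.projAut h𝒢 n).ker :=
  D.vertGen_ker_piLevelAut_le h𝒢 hconn T R n
    ((D.piPresentation h𝒢 T R).vertGen_stable hP (hN n e) (hc e) (hgen n hx))

end GaloisLevelData

end ProfiniteSemiGraph

end Literature.AnabelianGeometry.SemiGraphs
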